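import Summits.QuantumFields.YangMills.Theorems.UnitScaleTiltHalvingP1FlatPillar
import HarnessLib

/-!
# Route `UnitScaleTilt`, crux K1 child «MinimiserStabilityRegPr» (stmt-QuantumFields-19200), registered stub V2′ `stub_halvingStep` (v8∕v10 `BirthV10`) —
# **PILLAR P1♭, v1.1 TEXT (LEAD RULING L-2 (1)): THE CHART IDENTITY ON THE LEVEL-0 CUBE `□₀`** — `P1FlatPillarAt′`∕`P1FlatPillar′` with (ii′) «`u(z)⁻¹U⟨z,μ⟩u(z+e_μ) =
# exp(iηA⟨z,μ⟩)` for every fine bond with BOTH ends in `□₀`» in place of (ii) (the member's positive-level layers), and the knit back to the unprimed text of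
# record ✓ `HalvingP1FlatPillar` (so ✓ `…HalvingP1FlatPillarRows`, ✓ `…HalvingP1FlatPillarPackage`, ✓ `…HalvingStepOfPillars` consume the primed text through one line)

Cell `ym3-torus` (HUMAN RULING D-0037, YM ladder rung R3 — continuum SU(2) YM₃ on the torus is a RUNG, not the Clay problem), width seat `ym-ust-19200-w3` gen 4.
`--supports stmt-QuantumFields-19200 --as helper`; DEFINITIONS LANE (two `def … : Prop` with parameters + knit theorems); 0 sorry, standard axioms.

WHY (★w1-19200 g7's located fact, adopted by LEAD RULING L-2 (1)).  Print's region for (152)∕(156) includes `Λ′₀ = □₀ ∖ □₁` («j = 0, 1, …, k»); the tree's `Domains`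
have `Om 0 = univ`, so (ii) of ✓p619487 was stated on the positive-level layers `SideTouches (pullDom {InOm j} j)`, `1 ≤ j ≤ K − n` only.  Level-1 index bonds straddling
`∂□₁` have double-bar averages reading fine bonds of the OUTER block — outside those layers but inside the level-0 cube `□₀` of the aligned sequence
(`FlatCubeSequenceAligned.cubeSetM x (K−n) ρ S M 0 = {y | y ∈ cubeFinM x (K−n) ρ S M 0}`, radius `radM (K−n)` around `x`).  (ii′) asks the identity for every fine bond with
both ends in a region `Ω₀` (generic in `P1FlatPillarAt′`; `Ω₀ := □₀` in `P1FlatPillar′`); the separation `S ≥ 1` of the aligned sequence puts every bond side-touching a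
positive-level domain inside `□₀`, so (ii′) ⟹ (ii).

WHAT THIS FILE PROVES ∕ DEFINES (0 sorry):
* §1 `P1FlatPillarAt'` ((o), (i), (ii′) on `Ω₀`, (iii), (iv), (vi), (vii) — VERBATIM ✓p619487 except (ii′)), `P1FlatPillar'` (`Ω₀ := cubeSetM x (K−n) ρ S M 0`).
* §2 `p1FlatPillarAt_of_prime` — `P1FlatPillarAt′ … Ω₀ …` ⟹ `P1FlatPillarAt …` whenever every bond side-touching a positive-level domain has both ends in `Ω₀`.
* §3 geometry of `□₀`: `mem_cubeSetM_zero_iff`, `sep22_cubeFinM_zero` (`blockOf y ∈ cubeFinM x k ρ S M 1`, `y′ ∉ cubeFinM x k ρ S M 0` ⟹ `S + 1 ≤ dist₀(y, y′)` — the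
  `j = 0` case ✓`sep22_cubeSeqM` loses to `Om 0 = univ`), `corner_dist_le_one` (two corners of a plaquette are `dist₀ ≤ 1` apart on the torus),
  ★`sideTouches_subset_cube0` (`1 ≤ S`: both ends of a bond side-touching `pullDom {InOm j} j`, `1 ≤ j ≤ K−n`, lie in `□₀`).
* §4 ★`p1FlatPillar_of_prime (hS : 1 ≤ S) : P1FlatPillar' L ρ S M hM a Cr B₁ C₁ C₂ → P1FlatPillar L ρ S M hM a Cr B₁ C₁ C₂`.
HONEST SCOPE.  Definitions, a reshuffle and torus geometry; NOT a claim about the stub, the crux, the rung or the mass gap.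

References: T. Bałaban, CMP **102** (1985) 277–309 [Balaban1985Variational] (144) p.300, (150)–(156) pp.301–302; CMP **99** (1985) 75–102 [Balaban1985RegularSpaces]
Thm 2 p.83, (1.36) p.82; CMP **96** (1984) 223–250 [Balaban1984PropagatorsII] (2.1)–(2.2) p.224.
-/

set_option autoImplicit false

noncomputable section

open scoped BigOperators Matrix.Norms.L2Operator

namespace Summit.QuantumFields.YangMills.Theorems.HalvingP1FlatPillarPrime

open Literature.MathematicalPhysics.QuantumFieldTheory.Balaban1983to89
open Literature.MathematicalPhysics.QuantumFieldTheory.Balaban1983to89.T3ContinuumYM3Torus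
open Literature.MathematicalPhysics.QuantumFieldTheory.Balaban1983to89.T3PrintedRegularMinimiser
open Literature.MathematicalPhysics.QuantumFieldTheory.Balaban1983to89.T3Thm1Carrier
open Complex (I)
open B5Eq117TorusCarriers (Mk)
open B5Eq118OneStroke (iterBlockOf iterBlockOf_zero iterBlockOf_succ)
open B5Prop12FieldsLattice (distSite distSite_nonneg)
open B5RowSumsP12Lattice (distSite_comm distSite_triangle)
open B6SectADomainsV1 (Domains)
open B6SectAOperatorsV1 (BondIdx SiteIdx)
open B7Prop1Explicit (e expUnit)
open B8Ineq132 (PlaqTouches)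
open B8Eq140Level (SideTouches IsSide)
open B8Thm2SetupTorus (pullDom mem_pullSet)
open B10Eq27TorusAxialLog (transl unitsField toUField transl_add_e)
open LatticeFieldCalculus (laplace diverg siteAvgIter)
open FlatCubeOpsText (IsLevWeight)
open FlatCubeSequence (distSite_le_blockOf)
open FlatCubeSequenceAligned (cubeSeqMT3 cubeSeqM cubeSeqM_Om_pos cubeSetM cubeFinM radM radM_succ mem_cubeFinM_of_dist dist_le_of_mem_cubeFinM)
open HalvingSiteAssembly (distSite_transl_le_one e_apply_mem01 e_add_e_apply_mem01)
open HalvingP1FlatPillar (DP1Clause P1FlatPillarAt P1FlatPillar)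
open Summit.QuantumFields.YangMills.Theorems.Prop8ChartDoubleBar (chartLogFlat)

/-! ## §1 The primed texts -/

section Defs

variable (F : T3Family) (n K : ℕ)

/-- **PILLAR P1♭ AT ONE SITE, v1.1 TEXT** — as ✓`HalvingP1FlatPillar.P1FlatPillarAt` with the chart identity (ii′) asked on every fine bond `⟨0 + z, μ⟩` whose two
end-points lie in the region `Ω₀` (print's `□₀`, [Balaban1985Variational] (150)∕(152) «j = 0, 1, …, k») instead of the member's positive-level layers.
[cite: Balaban1985RegularSpaces, Thm 2 p.83, (1.36)-(1.38) p.82; Balaban1985Variational, (150)-(156) pp.301-302, (160) p.303] -/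
def P1FlatPillarAt' (D : Domains (F.P K)) (Ω₀ : Set (Site (F.P K) 0)) (x : Site (F.P K) 0) (ε₀ ε₁ B₁ C₁ C₂ : ℝ)
    (U : GaugeField (F.P K) 0 (Matrix.specialUnitaryGroup (Fin 2) ℂ)) : Prop :=
  ∃ (u : GaugeTransf (F.P K) 0 (Matrix.unitaryGroup (Fin 2) ℂ)) (A : PBond (F.P K) 0 → Matrix (Fin 2) (Fin 2) ℂ),
    DP1Clause F n K D x U u ∧
    (∀ b : PBond (F.P K) 0, IsSelfAdjoint (A b)) ∧ (∀ b : PBond (F.P K) 0, Matrix.trace (A b) = 0) ∧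
    (∀ (z : B7Prop1Explicit.Site (F.P K).d) (μ : Fin (F.P K).d), transl (0 : Site (F.P K) 0) z ∈ Ω₀ → (transl (0 : Site (F.P K) 0) z).shift μ ∈ Ω₀ →
      (Unitary.toUnits (u (transl 0 z)))⁻¹ * unitsField (toUField U) ⟨transl 0 z, μ⟩ * Unitary.toUnits (u ((transl 0 z).shift μ)) =
        expUnit (I • ((((F.L : ℝ)⁻¹) ^ (K - n)) • A ⟨transl 0 z, μ⟩))) ∧
    (∀ w : ℕ → PBond (F.P K) 0 → ℝ, IsLevWeight F n K D w →
      (∀ b : PBond (F.P K) 0, w 1 b * ‖A b‖ ≤ B₁ * ε₀) ∧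
      (∀ (b : PBond (F.P K) 0) (ν : Fin (F.P K).d), w 2 b * (F.L : ℝ) ^ (K - n) * ‖A ⟨b.src.shift ν, b.dir⟩ - A b‖ ≤ B₁ * ε₀)) ∧
    (∃ μ : SiteIdx D → Matrix (Fin 2) (Fin 2) ℂ, ∀ s : Site (F.P K) 0,
      laplace ((F.L : ℝ) ^ (K - n)) (diverg ((F.L : ℝ) ^ (K - n)) A) s =
        ∑ i : SiteIdx D, siteAvgIter (i.1.1 : ℕ) (Pi.single s (1 : ℝ)) i.1.2 • μ i) ∧
    (∀ c : BondIdx D, (c.1.1 : ℕ) = K - n → c.1.2.src ∈ D.Om (c.1.1 : ℕ) → c.1.2.tgt ∈ D.Om (c.1.1 : ℕ) →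
      ‖chartLogFlat (((F.L : ℝ)⁻¹) ^ (K - n)) D A c‖ ≤
        C₁ * ε₁ * (distSite (Mk (F.P K) (c.1.1 : ℕ)) c.1.2.src (iterBlockOf (c.1.1 : ℕ) x) + 1)) ∧
    (∀ c : BondIdx D, ‖chartLogFlat (((F.L : ℝ)⁻¹) ^ (K - n)) D A c‖ ≤ C₂ * ε₀)

/-- **PILLAR P1♭, v1.1 TEXT** — as ✓`HalvingP1FlatPillar.P1FlatPillar` with `P1FlatPillarAt′` at `Ω₀ := cubeSetM x (K−n) ρ S M 0`, the level-0 cube `□₀` of the aligned cube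
sequence of `x`. [cite: Balaban1985RegularSpaces, Thm 2 p.83; Balaban1985Variational, Prop 2 p.281, (144) p.300, (152)-(156) pp.301-302, (160) p.303] -/
def P1FlatPillar' (L ρ S M : ℕ) (hM : 1 ≤ M) (a Cr B₁ C₁ C₂ : ℝ) : Prop :=
  ∀ F : T3Family, F.L = L → ∀ (n K : ℕ) (hnK : n < K) (ε₀ ε₁ : ℝ), 0 < ε₁ → 0 < ε₀ → ε₀ ≤ a → Cr * ε₁ ≤ ε₀ →
    ∀ V : GaugeField (F.P n) 0 (Matrix.specialUnitaryGroup (Fin 2) ℂ), PlaqSmall ε₁ V →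
      ∀ U ∈ regFibrePr F n K hnK.le ε₀ V, ∀ x : Site (F.P K) 0,
        P1FlatPillarAt' F n K (cubeSeqMT3 F n K x ρ S M hM) (cubeSetM x (K - n) ρ S M 0) x ε₀ ε₁ B₁ C₁ C₂ U

end Defs

/-! ## §2 The primed text implies the unprimed one whenever the layers lie in `Ω₀` -/

section Knit

variable {F : T3Family} {n K : ℕ}

/-- **`P1FlatPillarAt′ ⟹ P1FlatPillarAt`** whenever both ends of every bond side-touching a positive-level domain of the member lie in `Ω₀`.
[cite: Balaban1985Variational, (150)-(152) p.301] -/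
theorem p1FlatPillarAt_of_prime (D : Domains (F.P K)) {Ω₀ : Set (Site (F.P K) 0)} (x : Site (F.P K) 0) {ε₀ ε₁ B₁ C₁ C₂ : ℝ}
    {U : GaugeField (F.P K) 0 (Matrix.specialUnitaryGroup (Fin 2) ℂ)}
    (hΩ : ∀ j, 1 ≤ j → j ≤ K - n → ∀ (z : B7Prop1Explicit.Site (F.P K).d) (μ : Fin (F.P K).d),
      SideTouches (pullDom (fun i => {y : Site (F.P K) 0 | D.InOm i y}) j) z μ →
      transl (0 : Site (F.P K) 0) z ∈ Ω₀ ∧ (transl (0 : Site (F.P K) 0) z).shift μ ∈ Ω₀)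
    (h : P1FlatPillarAt' F n K D Ω₀ x ε₀ ε₁ B₁ C₁ C₂ U) : P1FlatPillarAt F n K D x ε₀ ε₁ B₁ C₁ C₂ U := by
  obtain ⟨u, A, ho, hsa, htr, hii, hiii, hiv, hvi, hvii⟩ := h
  exact ⟨u, A, ho, hsa, htr, fun j h1 hjk z μ hz => hii z μ (hΩ j h1 hjk z μ hz).1 (hΩ j h1 hjk z μ hz).2, hiii, hiv, hvi, hvii⟩

end Knit

/-! ## §3 Geometry of the level-0 cube `□₀` -/

section Geometry

variable {P : Params}

/-- membership in `□₀` as a set of fine sites is membership in the level-0 saturated cube. [cite: Balaban1985Variational, (144) p.300] -/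
theorem mem_cubeSetM_zero_iff (x₀ : Site P 0) (k ρ S M : ℕ) (y : Site P 0) : y ∈ cubeSetM x₀ k ρ S M 0 ↔ y ∈ cubeFinM x₀ k ρ S M 0 := by
  simp [cubeSetM]

/-- **(2.2) AT LEVEL 0 FOR THE ALIGNED CUBES**: a fine site whose block lies in `□₁` is at distance `≥ S + 1` from every fine site outside `□₀` (`1 ≤ k`).
[cite: Balaban1984PropagatorsII, (2.2) p.224; Balaban1985Variational, (144) p.300] -/
theorem sep22_cubeFinM_zero (x₀ : Site P 0) {k : ℕ} (hk : k ≤ P.m + P.K) (hk1 : 1 ≤ k) (ρ S M : ℕ) (hM : 1 ≤ M) (y y' : Site P 0)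
    (hy : blockOf y ∈ cubeFinM x₀ k ρ S M 1) (hy' : y' ∉ cubeFinM x₀ k ρ S M 0) : (S : ℝ) + 1 ≤ distSite (Mk P 0) y y' := by
  have hj : 0 + 1 ≤ P.m + P.K := by omega
  have hkj : k - 0 = (k - 1) + 1 := by omega
  have hL0 : (0 : ℝ) ≤ P.L := Nat.cast_nonneg _
  -- `y` is within `L·(radM(k−1) + M − 1) + (L − 1)` of `x₀`
  have h1 : distSite (Mk P 0) y (iterBlockOf 0 x₀) ≤ (P.L : ℝ) * ((radM P.L M ρ S (k - 1) : ℝ) + ((M : ℝ) - 1)) + ((P.L : ℝ) - 1) := by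
    have hd := dist_le_of_mem_cubeFinM (x₀ := x₀) (k := k) (ρ := ρ) (S := S) hM hy
    have := distSite_le_blockOf hj y (iterBlockOf 0 x₀)
    rw [← FlatCubeSequence.iterBlockOf_succ'] at this
    have h2 := mul_le_mul_of_nonneg_left hd hL0
    linarith
  -- `y′` is outside the ball of radius `radM k`
  have h3 : (radM P.L M ρ S (k - 0) : ℝ) < distSite (Mk P 0) y' (iterBlockOf 0 x₀) := by
    by_contra hle
    rw [not_lt] at hle
    exact hy' (mem_cubeFinM_of_dist x₀ k ρ S M 0 hle)
  have h4 : (radM P.L M ρ S (k - 0) : ℝ) = (P.L : ℝ) * (radM P.L M ρ S (k - 1) : ℝ) + ((P.L : ℝ) * M - 1) + (S : ℝ) := by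
    rw [hkj, radM_succ]
    have hLM : 1 ≤ P.L * M := Nat.one_le_iff_ne_zero.mpr (Nat.mul_ne_zero P.L_pos.ne' (by omega))
    have hsub : ((P.L * M - 1 : ℕ) : ℝ) = (P.L : ℝ) * M - 1 := by rw [Nat.cast_sub hLM, Nat.cast_mul, Nat.cast_one]
    push_cast
    rw [hsub]
  have htri := distSite_triangle (Mk P 0) (iterBlockOf 0 x₀) y y'
  rw [distSite_comm (Mk P 0) (iterBlockOf 0 x₀) y] at htri
  rw [distSite_comm (Mk P 0) y' (iterBlockOf 0 x₀)] at h3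
  -- integrality
  have hint : ((radM P.L M ρ S (k - 0) : ℕ) : ℝ) + 1 ≤ distSite (Mk P 0) (iterBlockOf 0 x₀) y' := by
    unfold distSite at h3 ⊢
    have := (Nat.cast_lt (α := ℝ)).1 h3
    exact_mod_cast this
  nlinarith [hL0]

/-- **TWO CORNERS OF A PLAQUETTE ARE AT TORUS DISTANCE `≤ 1`**: for `c′, a′ ∈ {0, e_κ, e_ν, e_κ + e_ν}` (coordinates in `{0,1}`),
`dist₀(0 + (z + a′), 0 + (z + c′)) ≤ 1`. [cite: Balaban1985RegularSpaces, p.77 (convention before (1.5))] -/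
theorem corner_dist_le_one (z a' c' : B7Prop1Explicit.Site P.d) (ha : ∀ i, a' i = 0 ∨ a' i = 1) (hc : ∀ i, c' i = 0 ∨ c' i = 1) :
    distSite (Mk P 0) (transl (0 : Site P 0) (z + a')) (transl 0 (z + c')) ≤ 1 := by
  refine distSite_transl_le_one fun i => ?_
  have hdiff : (z + a') i - (z + c') i = a' i - c' i := by rw [Pi.add_apply, Pi.add_apply]; ring
  rw [hdiff]
  rcases ha i with h | h <;> rcases hc i with h' | h' <;> norm_num [h, h']

end Geometry

section CubeSeq

variable {F : T3Family} {n K : ℕ}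

/-- ★ **BOTH ENDS OF A BOND SIDE-TOUCHING A POSITIVE-LEVEL DOMAIN LIE IN `□₀`** (aligned cube sequence of `x` with separation `S ≥ 1`): the touching corner lies in
`st(Ω_j) ⊆ st(Ω₁)`, whose block is in `□₁`; every corner of the plaquette is within `dist₀ ≤ 1 < S + 1` of it.
[cite: Balaban1984PropagatorsII, (2.1)-(2.2) p.224; Balaban1985Variational, (144) p.300] -/
theorem sideTouches_subset_cube0 (x : Site (F.P K) 0) (ρ S M : ℕ) (hM : 1 ≤ M) (hS : 1 ≤ S) :
    ∀ j, 1 ≤ j → j ≤ K - n → ∀ (z : B7Prop1Explicit.Site (F.P K).d) (μ : Fin (F.P K).d),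
      SideTouches (pullDom (fun i => {y : Site (F.P K) 0 | (cubeSeqMT3 F n K x ρ S M hM).InOm i y}) j) z μ →
      transl (0 : Site (F.P K) 0) z ∈ cubeSetM x (K - n) ρ S M 0 ∧ (transl (0 : Site (F.P K) 0) z).shift μ ∈ cubeSetM x (K - n) ρ S M 0 := by
  intro j h1 hjk z μ hz
  obtain ⟨z', κ, ν, hκν, hP, hsd⟩ := hz
  -- a corner `c = z′ + c′` of the plaquette in `st(Ω_j)`
  obtain ⟨c', hc, hc01⟩ : ∃ c' : B7Prop1Explicit.Site (F.P K).d,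
      (cubeSeqMT3 F n K x ρ S M hM).InOm j (transl (0 : Site (F.P K) 0) (z' + c')) ∧ ∀ i, c' i = 0 ∨ c' i = 1 := by
    rcases hP with h0 | h0 | h0 | h0
    · exact ⟨0, by rw [add_zero]; exact (mem_pullSet _ _ _).1 h0, fun i => Or.inl rfl⟩
    · exact ⟨e κ, (mem_pullSet _ _ _).1 h0, e_apply_mem01 κ⟩
    · exact ⟨e ν, (mem_pullSet _ _ _).1 h0, e_apply_mem01 ν⟩
    · exact ⟨e κ + e ν, by rw [← add_assoc]; exact (mem_pullSet _ _ _).1 h0, e_add_e_apply_mem01 hκν⟩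
  -- its block lies in `□₁`
  have hc1 : (cubeSeqMT3 F n K x ρ S M hM).InOm 1 (transl (0 : Site (F.P K) 0) (z' + c')) :=
    (cubeSeqMT3 F n K x ρ S M hM).inOm_of_le h1 hc
  have hblk : blockOf (transl (0 : Site (F.P K) 0) (z' + c')) ∈ cubeFinM x (K - n) ρ S M 1 := by
    have h' : iterBlockOf 1 (transl (0 : Site (F.P K) 0) (z' + c')) ∈
        (cubeSeqM x (K - n) (FlatMinimizerH.le_T3 F n K) ρ S M hM).Om 1 := hc1
    rwa [cubeSeqM_Om_pos x (FlatMinimizerH.le_T3 F n K) ρ S M hM le_rfl (by omega)] at h'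
  -- any corner of the plaquette lies in `□₀`
  have key : ∀ a' : B7Prop1Explicit.Site (F.P K).d, (∀ i, a' i = 0 ∨ a' i = 1) →
      transl (0 : Site (F.P K) 0) (z' + a') ∈ cubeSetM x (K - n) ρ S M 0 := by
    intro a' ha
    rw [mem_cubeSetM_zero_iff]
    by_contra hout
    have hsep := sep22_cubeFinM_zero x (FlatMinimizerH.le_T3 F n K) (by omega) ρ S M hM _ _ hblk hout
    have hd := corner_dist_le_one (P := F.P K) z' c' a' hc01 ha
    have hS1 : (1 : ℝ) ≤ (S : ℝ) := by exact_mod_cast hS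
    linarith
  -- the two ends of the side
  rcases hsd with ⟨hy, hτ⟩ | ⟨hy, hτ⟩ | ⟨hy, hτ⟩ | ⟨hy, hτ⟩ <;> rw [hy, hτ]
  · have h0 := key 0 (fun i => Or.inl rfl)
    rw [add_zero] at h0
    exact ⟨h0, by rw [← transl_add_e]; exact key (e κ) (e_apply_mem01 κ)⟩
  · exact ⟨key (e κ) (e_apply_mem01 κ), by rw [← transl_add_e, add_assoc]; exact key (e κ + e ν) (e_add_e_apply_mem01 hκν)⟩
  · exact ⟨key (e ν) (e_apply_mem01 ν), by
      rw [← transl_add_e, add_assoc, add_comm (e ν) (e κ)]; exact key (e κ + e ν) (e_add_e_apply_mem01 hκν)⟩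
  · have h0 := key 0 (fun i => Or.inl rfl)
    rw [add_zero] at h0
    exact ⟨h0, by rw [← transl_add_e]; exact key (e ν) (e_apply_mem01 ν)⟩

/-- ★ **THE PRIMED PILLAR IMPLIES THE PILLAR OF RECORD** (separation `S ≥ 1`). [cite: Balaban1985Variational, (144) p.300, (152)-(156) pp.301-302] -/
theorem p1FlatPillar_of_prime {L ρ S M : ℕ} {hM : 1 ≤ M} {a Cr B₁ C₁ C₂ : ℝ} (hS : 1 ≤ S) (h : P1FlatPillar' L ρ S M hM a Cr B₁ C₁ C₂) :
    P1FlatPillar L ρ S M hM a Cr B₁ C₁ C₂ :=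
  fun F hF n K hnK ε₀ ε₁ hε₁ hε₀ hε₀a hCr V hV U hU x =>
    p1FlatPillarAt_of_prime (cubeSeqMT3 F n K x ρ S M hM) x (sideTouches_subset_cube0 x ρ S M hM hS)
      (h F hF n K hnK ε₀ ε₁ hε₁ hε₀ hε₀a hCr V hV U hU x)

end CubeSeq

end Summit.QuantumFields.YangMills.Theorems.HalvingP1FlatPillarPrime

end
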